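import Summits.Ventures.YMGap.RobustBall.IsingBallB2
import Summits.Ventures.YMGap.RobustBall.ZTwoLayerGraph
import Literature.Probability.LatticeModels.IsingTransport
import HarnessLib

/-!
# RobustBall/IsingBallB2Embed — the balls `B₂(a)` inside the layer graph of the torus: the explicit ball `B2V` embeds as an INDUCED subgraph
# (`L ≥ 6`), so its layer two-point functions are those of `b2Graph` (transport)

HONEST FRAMING: venture file of the cell `pub-ymgap` (QuantumFields programme), track Y2 ROBUST-BALL / DS seat ds-4 (g10).  Finite statements about the
free-boundary Ising model on the layer graph `layerGraph i H` of the discrete torus `(ℤ/L)^4` (`ZTwoLayerGraph`); no `SU(2)` measure here (that is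
`CentreBlindBallWindow`); nothing about the continuum.

WHAT.  For `L ≥ 6` and a site `a` at a selected `i`-height, the explicit ball `B2V` (`IsingBallB2`) EMBEDS into the layer graph around `a`
(`ballEmb`: `p ↦ a + ∑_k off(p)_k e_{i.succAbove k}`, offsets `off` kernel-decided), injectively (`ballEmb_injective`) and as an INDUCED-subgraph
isomorphism (`layerGraph_adj_ballEmb_iff`: `L ≥ 6` makes the torus identifications invisible on the ball, whose offsets have coordinates `≤ 2`);
so by transport (`isingTwoPoint_free_map`) the two-point functions of the layer model inside `B₂(a) = ballSet` ARE those of `b2Graph`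
(`isingTwoPoint_ballSet_eq`), and `B₂(a)` has `dist_j`-radius `2` (`jDist_ballEmb_le`).  The certificate and the two-point bound are in
`IsingBallB2Layer`.

References: B. Simon, Comm. Math. Phys. 77 (1980) 111; E. Lieb, Comm. Math. Phys. 77 (1980) 127; H. Duminil-Copin, V. Tassion, Comm. Math. Phys. 343
(2016) 725, Lemma 2.7.
-/

noncomputable section

open Finset
open Literature.Probability.LatticeModels
open Literature.MathematicalPhysics.QuantumFieldTheory

namespace Summit.Ventures.YMGap.RobustBall

namespace ZTwo

open B2V ZN

variable {L : ℕ}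

/-! ### Integer offsets of the ball and their arithmetic (kernel-decided) -/

/-- The sign of a Boolean as an integer. [folklore] -/
def sgnZ (s : Bool) : ℤ := if s then 1 else -1

/-- The offset of a ball site in `ℤ³`. [folklore] -/
def ballOff : B2V → (Fin 3 → ℤ)
  | centre => 0
  | mid k s => Pi.single k (sgnZ s)
  | axis k s => Pi.single k (2 * sgnZ s)
  | corner k s s' => Pi.single (k + 1) (sgnZ s) + Pi.single (k + 2) (sgnZ s')

/-- Offsets are injective. [folklore] -/
theorem off_injective : ∀ p q : B2V, ballOff p = ballOff q → p = q := by decide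

/-- Adjacent ball sites differ by a unit vector. [folklore] -/
theorem exists_unit_of_adj : ∀ p q : B2V, B2V.adj p q →
    ∃ k : Fin 3, ballOff q = ballOff p + Pi.single k 1 ∨ ballOff p = ballOff q + Pi.single k 1 := by decide

/-- Ball sites differing by a unit vector are adjacent. [folklore] -/
theorem adj_of_unit : ∀ (p q : B2V) (k : Fin 3),
    (ballOff q = ballOff p + Pi.single k 1 ∨ ballOff q = ballOff p + Pi.single k (-1)) → B2V.adj p q := by decide

/-- A unit step from the centre or a middle site stays in the ball. [folklore] -/
theorem exists_of_inner_step : ∀ (p : B2V) (k : Fin 3), (p = centre ∨ ∃ k' s', p = mid k' s') →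
    (∃ q : B2V, ballOff q = ballOff p + Pi.single k 1) ∧ ∃ q : B2V, ballOff q = ballOff p + Pi.single k (-1) := by decide

/-- Offsets have coordinates of absolute value `≤ 2`. [folklore] -/
theorem abs_off_le : ∀ (p : B2V) (k : Fin 3), |ballOff p k| ≤ 2 := by decide

/-! ### The embedding of the ball into the layer graph -/

/-- The offset homomorphism `u ↦ ∑_k u_k e_{i.succAbove k}` from `ℤ³` into the torus sites (the three directions other than `i`). [folklore] -/
def offHom (i : Fin 4) : (Fin 3 → ℤ) →+ Site 4 L where
  toFun u := ∑ k : Fin 3, Pi.single (i.succAbove k) ((u k : ℤ) : ZMod L)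
  map_zero' := by simp
  map_add' u u' := by simp [Pi.single_add, sum_add_distrib]

/-- Unfolding `offHom`. [folklore] -/
theorem offHom_apply (i : Fin 4) (u : Fin 3 → ℤ) :
    offHom (L := L) i u = ∑ k : Fin 3, (Pi.single (i.succAbove k) ((u k : ℤ) : ZMod L) : Site 4 L) := rfl

/-- `offHom` on a coordinate vector. [folklore] -/
theorem offHom_single (i : Fin 4) (k : Fin 3) (z : ℤ) :
    offHom (L := L) i (Pi.single k z) = (Pi.single (i.succAbove k) ((z : ℤ) : ZMod L) : Site 4 L) := by
  rw [offHom_apply, Fintype.sum_eq_single k]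
  · simp
  · intro k' hk'; simp [Pi.single_eq_of_ne hk']

/-- `offHom u` has no `i`-component. [folklore] -/
theorem offHom_apply_self (i : Fin 4) (u : Fin 3 → ℤ) : offHom (L := L) i u i = 0 := by
  rw [offHom_apply, Finset.sum_apply]
  exact sum_eq_zero fun k _ => Pi.single_eq_of_ne (Fin.succAbove_ne i k).symm _

/-- The `i.succAbove k`-component of `offHom u` is `u_k`. [folklore] -/
theorem offHom_apply_succAbove (i : Fin 4) (u : Fin 3 → ℤ) (k : Fin 3) : offHom (L := L) i u (i.succAbove k) = ((u k : ℤ) : ZMod L) := by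
  rw [offHom_apply, Finset.sum_apply, Fintype.sum_eq_single k]
  · simp
  · intro k' hk'; exact Pi.single_eq_of_ne (fun h => hk' (Fin.succAbove_right_injective h).symm) _

/-- **Small integer vectors are determined by their image in the torus**: if `|u_k| < L` for all `k` and `offHom u = 0` then `u = 0`. [folklore] -/
theorem eq_zero_of_offHom_eq_zero (i : Fin 4) {u : Fin 3 → ℤ} (hu : ∀ k, |u k| < (L : ℤ)) (h : offHom (L := L) i u = 0) : u = 0 := by
  funext k
  have hk := congrFun h (i.succAbove k)
  rw [offHom_apply_succAbove, Pi.zero_apply, ZMod.intCast_zmod_eq_zero_iff_dvd] at hk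
  exact Int.eq_zero_of_abs_lt_dvd hk (hu k)

/-- **The embedding of the ball around `a`**: `p ↦ a + ∑_k off(p)_k e_{i.succAbove k}`. [folklore] -/
def ballEmb (i : Fin 4) (a : Site 4 L) (p : B2V) : Site 4 L := a + offHom i (ballOff p)

/-- The centre goes to `a`. [folklore] -/
@[simp] theorem ballEmb_centre (i : Fin 4) (a : Site 4 L) : ballEmb i a centre = a := by
  simp [ballEmb, ballOff]

/-- The embedded ball lies at the `i`-height of `a`. [folklore] -/
theorem ballEmb_apply_self (i : Fin 4) (a : Site 4 L) (p : B2V) : ballEmb i a p i = a i := by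
  simp [ballEmb, offHom_apply_self]

/-- The embedding is injective for `L ≥ 6` (offsets have coordinates `≤ 2 < L/2`). [folklore] -/
theorem ballEmb_injective (hL : 6 ≤ L) (i : Fin 4) (a : Site 4 L) : Function.Injective (ballEmb (L := L) i a) := by
  intro p q h
  have h1 : offHom (L := L) i (ballOff p - ballOff q) = 0 := by
    rw [map_sub, sub_eq_zero]; exact add_left_cancel h
  have h2 := eq_zero_of_offHom_eq_zero i (fun k => ?_) h1
  · exact off_injective p q (sub_eq_zero.1 h2)
  · have hp := abs_off_le p k
    have hq := abs_off_le q k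
    have : |ballOff p k - ballOff q k| ≤ |ballOff p k| + |ballOff q k| := abs_sub _ _
    have hL' : (6 : ℤ) ≤ L := by exact_mod_cast hL
    rw [Pi.sub_apply]; omega

/-- The embedding as a `Function.Embedding`. [folklore] -/
def ballEmbedding (hL : 6 ≤ L) (i : Fin 4) (a : Site 4 L) : B2V ↪ Site 4 L := ⟨ballEmb i a, ballEmb_injective hL i a⟩

/-- **The ball `B₂(a)`** in the layer: the image of the embedding. [folklore] -/
def ballSet (hL : 6 ≤ L) (i : Fin 4) (a : Site 4 L) : Finset (Site 4 L) := (univ : Finset B2V).map (ballEmbedding hL i a)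

/-- `a ∈ B₂(a)`. [folklore] -/
theorem mem_ballSet_self (hL : 6 ≤ L) (i : Fin 4) (a : Site 4 L) : a ∈ ballSet hL i a := by
  rw [ballSet, mem_map]; exact ⟨centre, mem_univ _, ballEmb_centre i a⟩

/-- Embedded sites are in the ball. [folklore] -/
theorem ballEmb_mem_ballSet (hL : 6 ≤ L) (i : Fin 4) (a : Site 4 L) (p : B2V) : ballEmb i a p ∈ ballSet hL i a := by
  rw [ballSet, mem_map]; exact ⟨p, mem_univ _, rfl⟩

/-! ### Adjacency: the embedding is an induced-subgraph isomorphism -/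

section Layer

variable [NeZero L]

/-- **A unit step inside a selected layer is an edge of the layer graph** (`L ≥ 2`, `v ≠ i`, `y_i ∈ H`). [folklore] -/
theorem layerGraph_adj_shift (hL : 2 ≤ L) {i : Fin 4} {H : Finset (ZMod L)} {y : Site 4 L} (hy : y i ∈ H) {v : Fin 4} (hv : v ≠ i) :
    (layerGraph i H).Adj y (y.shift v) := by
  rw [layerGraph_adj]
  refine ⟨(Balaban1983to89.StrongCouplingTorusWindow.shift_ne_self (by omega) y v).symm, Or.inl ?_⟩
  rcases lt_or_gt_of_ne hv with h | h
  · refine ⟨(y, ⟨(v, i), h⟩), mem_layerPlaqs.2 ⟨Or.inr rfl, hy⟩, rfl, ?_⟩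
    simp [otherDir, hv]
  · refine ⟨(y, ⟨(i, v), h⟩), mem_layerPlaqs.2 ⟨Or.inl rfl, hy⟩, rfl, ?_⟩
    simp [otherDir]

/-- A signed unit step inside a selected layer is an edge of the layer graph. [folklore] -/
theorem layerGraph_adj_add_single (hL : 2 ≤ L) {i : Fin 4} {H : Finset (ZMod L)} {y : Site 4 L} (hy : y i ∈ H) {v : Fin 4} (hv : v ≠ i)
    {ε : ZMod L} (hε : ε = 1 ∨ ε = -1) : (layerGraph i H).Adj y (y + Pi.single v ε) := by
  rcases hε with rfl | rfl
  · exact layerGraph_adj_shift hL hy hv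
  · have hy' : (y + (Pi.single v (-1 : ZMod L) : Site 4 L)) i ∈ H := by
      rw [Pi.add_apply, Pi.single_eq_of_ne (Ne.symm hv), add_zero]; exact hy
    have h := layerGraph_adj_shift hL hy' hv
    have hs : (y + (Pi.single v (-1 : ZMod L) : Site 4 L)).shift v = y := by
      simp [Literature.MathematicalPhysics.QuantumFieldTheory.Site.shift, add_assoc, ← Pi.single_add]
    rw [hs] at h
    exact h.symm

/-- Adjacent sites of the layer graph lie in a selected layer. [folklore] -/
theorem height_mem_of_adj {i : Fin 4} {H : Finset (ZMod L)} {y y' : Site 4 L} (h : (layerGraph i H).Adj y y') : y i ∈ H := by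
  obtain ⟨-, h⟩ := layerGraph_adj.1 h
  rcases h with ⟨p, hp, rfl, -⟩ | ⟨p, hp, -, rfl⟩
  · exact (mem_layerPlaqs.1 hp).2
  · rw [Literature.MathematicalPhysics.QuantumFieldTheory.Site.shift, Pi.add_apply,
      Pi.single_eq_of_ne (otherDir_ne i p (mem_layerPlaqs.1 hp).1).symm, add_zero]
    exact (mem_layerPlaqs.1 hp).2

omit [NeZero L] in
/-- A `±1` of `ZMod L` is the cast of a `±1` of `ℤ`. [folklore] -/
theorem exists_int_cast_of_sign {ε : ZMod L} (hε : ε = 1 ∨ ε = -1) : ∃ e : ℤ, (e = 1 ∨ e = -1) ∧ ((e : ℤ) : ZMod L) = ε := by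
  rcases hε with rfl | rfl
  · exact ⟨1, Or.inl rfl, by simp⟩
  · exact ⟨-1, Or.inr rfl, by simp⟩

/-- **The embedded ball is an INDUCED copy of `b2Graph`** (`L ≥ 6`, `a` at a selected height). [folklore] -/
theorem layerGraph_adj_ballEmb_iff (hL : 6 ≤ L) {i : Fin 4} {H : Finset (ZMod L)} {a : Site 4 L} (ha : a i ∈ H) (p q : B2V) :
    (layerGraph i H).Adj (ballEmb i a p) (ballEmb i a q) ↔ b2Graph.Adj p q := by
  have hL2 : 2 ≤ L := by omega
  have hpH : ∀ r : B2V, ballEmb i a r i ∈ H := fun r => by rw [ballEmb_apply_self]; exact ha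
  constructor
  · intro h
    obtain ⟨v, hv, ε, hε, hq⟩ := exists_single_of_adj h
    obtain ⟨k, rfl⟩ := Fin.exists_succAbove_eq hv
    obtain ⟨e, he, rfl⟩ := exists_int_cast_of_sign hε
    -- `off q − off p − e·e_k` vanishes in the torus, hence in `ℤ³`
    have h0 : offHom (L := L) i (ballOff q - ballOff p - Pi.single k e) = 0 := by
      rw [map_sub, map_sub, offHom_single]
      have := hq; unfold ballEmb at this
      rw [add_assoc] at this
      have h' := add_left_cancel this
      rw [h']; abel
    have hsmall : ∀ k', |(ballOff q - ballOff p - Pi.single k e : Fin 3 → ℤ) k'| < (L : ℤ) := by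
      intro k'
      have h1 := abs_off_le q k'
      have h2 := abs_off_le p k'
      have h3 : |(Pi.single k e : Fin 3 → ℤ) k'| ≤ 1 := by
        by_cases hk : k' = k
        · subst hk; rw [Pi.single_eq_same]; rcases he with rfl | rfl <;> simp
        · rw [Pi.single_eq_of_ne hk]; simp
      have hL' : (6 : ℤ) ≤ L := by exact_mod_cast hL
      simp only [Pi.sub_apply]
      have := abs_sub (ballOff q k' - ballOff p k') ((Pi.single k e : Fin 3 → ℤ) k')
      have := abs_sub (ballOff q k') (ballOff p k')
      omega
    have hz := eq_zero_of_offHom_eq_zero i hsmall h0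
    rw [sub_eq_zero, sub_eq_iff_eq_add'] at hz
    rcases he with rfl | rfl
    · exact adj_of_unit p q k (Or.inl hz)
    · exact adj_of_unit p q k (Or.inr hz)
  · intro h
    obtain ⟨k, hk | hk⟩ := exists_unit_of_adj p q h
    · have : ballEmb i a q = ballEmb i a p + Pi.single (i.succAbove k) (1 : ZMod L) := by
        unfold ballEmb; rw [hk, map_add, offHom_single, add_assoc]; simp
      rw [this]
      exact layerGraph_adj_add_single hL2 (hpH p) (Fin.succAbove_ne i k) (Or.inl rfl)
    · have : ballEmb i a p = ballEmb i a q + Pi.single (i.succAbove k) (1 : ZMod L) := by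
        unfold ballEmb; rw [hk, map_add, offHom_single, add_assoc]; simp
      rw [this]
      exact (layerGraph_adj_add_single hL2 (hpH q) (Fin.succAbove_ne i k) (Or.inl rfl)).symm

/-- **Transport**: the two-point functions of the layer model inside `B₂(a)` are those of `b2Graph`. [folklore] -/
theorem isingTwoPoint_ballSet_eq (hL : 6 ≤ L) {i : Fin 4} {H : Finset (ZMod L)} {a : Site 4 L} (ha : a i ∈ H) (β : ℝ) (p q : B2V) :
    isingTwoPoint (layerGraph i H) (ballSet hL i a) β 0 .free (ballEmb i a p) (ballEmb i a q) = isingTwoPoint b2Graph univ β 0 .free p q :=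
  isingTwoPoint_free_map (G := b2Graph) (G' := layerGraph i H) (ballEmbedding hL i a) (Λ := univ)
    (fun x _ y _ => layerGraph_adj_ballEmb_iff hL ha x y) β 0 p q

/-! ### Distances to the ball sites -/

/-- A signed unit step changes `dist_j` by at most one. [folklore] -/
theorem jDist_le_add_single (j : Fin 4) (t y : Site 4 L) (v : Fin 4) {ε : ZMod L} (hε : ε = 1 ∨ ε = -1) :
    jDist j t y ≤ jDist j t (y + Pi.single v ε) + 1 := by
  rcases hε with rfl | rfl
  · exact jDist_le_shift j t y v
  · have h := jDist_shift_le j t (y + Pi.single v (-1 : ZMod L)) v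
    have hs : (y + (Pi.single v (-1 : ZMod L) : Site 4 L)).shift v = y := by
      simp [Literature.MathematicalPhysics.QuantumFieldTheory.Site.shift, add_assoc, ← Pi.single_add]
    rw [hs] at h
    exact h

omit [NeZero L] in
/-- The sign cast is `±1`. [folklore] -/
theorem sgnZ_cast_eq_or (s : Bool) : ((sgnZ s : ℤ) : ZMod L) = 1 ∨ ((sgnZ s : ℤ) : ZMod L) = -1 := by
  cases s <;> simp [sgnZ]

/-- **The ball has `dist_j`-radius `2`**: `dist_j(t, a) ≤ dist_j(t, x) + 2` for every site `x` of `B₂(a)`. [folklore] -/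
theorem jDist_ballEmb_le (j : Fin 4) (t : Site 4 L) (i : Fin 4) (a : Site 4 L) (p : B2V) :
    jDist j t a ≤ jDist j t (ballEmb i a p) + 2 := by
  cases p with
  | centre => rw [ballEmb_centre]; omega
  | mid k s =>
      have h := jDist_le_add_single j t a (i.succAbove k) (sgnZ_cast_eq_or (L := L) s)
      have he : ballEmb i a (mid k s) = a + Pi.single (i.succAbove k) ((sgnZ s : ℤ) : ZMod L) := by
        unfold ballEmb ballOff; rw [offHom_single]
      rw [he]; omega
  | axis k s =>
      have h1 := jDist_le_add_single j t a (i.succAbove k) (sgnZ_cast_eq_or (L := L) s)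
      have h2 := jDist_le_add_single j t (a + Pi.single (i.succAbove k) ((sgnZ s : ℤ) : ZMod L)) (i.succAbove k)
        (sgnZ_cast_eq_or (L := L) s)
      have he : ballEmb i a (axis k s) = a + Pi.single (i.succAbove k) ((sgnZ s : ℤ) : ZMod L) +
          Pi.single (i.succAbove k) ((sgnZ s : ℤ) : ZMod L) := by
        unfold ballEmb ballOff; rw [offHom_single, add_assoc, ← Pi.single_add]; push_cast; ring_nf
      rw [he]; omega
  | corner k s s' =>
      have h1 := jDist_le_add_single j t a (i.succAbove (k + 1)) (sgnZ_cast_eq_or (L := L) s)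
      have h2 := jDist_le_add_single j t (a + Pi.single (i.succAbove (k + 1)) ((sgnZ s : ℤ) : ZMod L)) (i.succAbove (k + 2))
        (sgnZ_cast_eq_or (L := L) s')
      have he : ballEmb i a (corner k s s') = a + Pi.single (i.succAbove (k + 1)) ((sgnZ s : ℤ) : ZMod L) +
          Pi.single (i.succAbove (k + 2)) ((sgnZ s' : ℤ) : ZMod L) := by
        unfold ballEmb ballOff; rw [map_add, offHom_single, offHom_single, add_assoc]
      rw [he]; omega

end Layer

end ZTwo

end Summit.Ventures.YMGap.RobustBall

end
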